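import Mathlib.FieldTheory.RatFunc.AsPolynomial
import Mathlib.LinearAlgebra.Matrix.Notation
import Mathlib.LinearAlgebra.Matrix.Trace
import Mathlib.LinearAlgebra.Matrix.Determinant.Basic
import Literature.Computability.AlgebraicComplexity.GKSS19HardnessToHittingSets
import Literature.Computability.AlgebraicComplexity.CircuitDepth
import HarnessLib

/-!
# Medini–Shpilka 2021, §1: dense orbits in `VP_e` and `ΣΠΣ` — `k`-independent maps, the continuant
# orbit (hitting / interpolating sets), orbits of sparse polynomials and of diagonal tensors
# (density, generators, hitting sets), and the non-robustness of independent maps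

Typed literature (cell `val-lit`, cross-ladder typing seat x6; D-0064 one file per source
section-group; this file = §1.1 (Defs 9, 11, 15, 17, 19 and the group actions of §1.1.6) and §1.2
(the results on the continuant orbit, on `ΣΠ`/diagonal-tensor orbits, and §1.2.4) of the source).
HONEST FRAMING: cite-tagged statements of published results; typed ≠ proved ≠ endorsed;
`VP ≠ VNP` is NOT proved and nothing here is progress on it (LADDER-VALIANT V4: hitting sets for
ORBIT CLOSURES of small classes — the orbit-closure flavour of succinct generators; ideation).

Source: D. Medini, A. Shpilka, *Hitting sets and reconstruction for dense orbits in VP_e and ΣΠΣ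
circuits*, 36th Computational Complexity Conference (CCC 2021), LIPIcs 200, Art. 19,
doi:10.4230/LIPIcs.CCC.2021.19 = arXiv:2102.05632 [MediniShpilka2021]. NUMBERING (read this first).
Decl names and `[cite:]` tags use the PUBLISHED CCC 2021 numbering, checked on the LIPIcs text (held
as `paper:url-0b49268a7c1f`, page `19:N` = file `p00NN.txt`): Def 9 (closure), Def 11 (hitting set),
Def 15 (interpolating set), Def 17 (generator), Def 19 (`k`-independent map), Def 27 (continuant),
Thm 28, Cor 29, Thm 30, Thm 31, Def 40 (`T_{s,d}`), Def 41 (`ΣΠ^{GLaff}`), Thm 42, Thm 43, Cor 44,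
Thm 45, Thm 48. The held arXiv text `paper:arxiv-2102.05632` (corpus-tex, 44 chunks) renders the
§1 numbering `1.x` but DROPS the numbers of the `restatable` theorems, so its visible numbers are
shifted: arXiv-held ‹Def 1.5› = CCC Def 9, ‹Def 1.7› = Def 11, ‹Def 1.11› = Def 15, ‹Def 1.13› = Def 17,
‹Def 1.15› = Def 19, ‹Def 1.16› = Def 27, ‹thmhitcont› (unnumbered) = Thm 28, ‹Cor 1.17› = Cor 29,
‹Thm 1.18› = Thm 30, ‹Thm 1.19› = Thm 31, ‹Def 1.24› = Def 40, ‹Def 1.25› = Def 41, ‹Thm 1.26› = Thm 42,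
‹PITSINV› (unnumbered) = Thm 43, ‹Cor 1.27› = Cor 44, ‹PITsumSDMinv› (unnumbered) = Thm 45,
‹Thm 1.29› = Thm 48 (the cell's reading list "Thms 1.18/1.19/1.26/1.29" are these held numbers). Every
docstring gives both locators. The store's DOI field for the held text (`…APPROX/RANDOM.2021.30`) is a
metadata error (that DOI is Bhargava–Ghosh); the statements typed here were compared word by word
with the CCC text.

## Rendering (read by referees)

* `f(Ax + b)` for `f ∈ F[x_1..x_m]`, `A ∈ F^{n×n}`, `b ∈ F^n`, `n ≥ m` is eq. (2) of §1.1.6 LITERALLY: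
  substitute `x_i ↦ Σ_j A_{i,j} x_j + b_i` for `i ≤ m`, ignoring the last `n - m` rows
  (`MS2021.affSubst`); the orbit `f^{GLaff_n(F)} = {f(Ax+b) | A ∈ GL_n(F), b ∈ F^n}` is
  `MS2021.affOrbit n f`, `f^{GL_n(F)}` (no shift) is `MS2021.linOrbit n f` (footnote 8's remark that the
  honest ACTION is `f(Aᵀx + b)` does not change orbits).
* `k`-independent maps (Def 19): a `1`-independent map has variables `y_1..y_t, z_1`, typed as
  `Fin t ⊕ Unit`; a `k`-independent map is "a sum of `k` variable-disjoint `1`-independent polynomial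
  maps", typed with variables `Fin k × (Fin t ⊕ Unit)` (block `l` = copy `l`), `MS2021.IsIndependent`;
  "uniform" = all coordinates homogeneous of one degree. `f ∘ G` is `MvPolynomial.bind₁ G f`.
* Hitting / interpolating sets and generators for a class (Defs 11, 15, 17): the generic predicates
  `HittingSets.IsHittingSetFor`, `HittingSets.IsGeneratorFor` (tree, `GKSS19HardnessToHittingSets.lean`)
  and `MS2021.IsInterpolatingSetFor` here.
* "Explicit" (Cor 29, Thm 30, Cor 44) is an algorithmic attribute; the typed statements keep the
  EXISTENCE of the set with the printed SIZE bound and drop explicitness (flag WEAKER — for these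
  infinite classes existence with the stated size is still a contentful claim, but the constructive
  content is not captured). The small-field clauses ("if `|F| < n²` then `H` is defined over an
  extension field") are typed as the hypothesis `Infinite F ∨ n² ≤ |F|` (`Nat.card`), i.e. only the
  large-field case is asserted.
* Thm 31 (deterministic reconstruction with a root-finding ORACLE and black-box access) is NOT typed:
  the tree has no model of oracle algorithms with black-box polynomial access (recorded NOT-TYPED).
* CLASSES OF FAMILIES and CLOSURE (Def 9) for Thm 42: a family is `f : ∀ n, MvPolynomial (Fin n) K`
  (`f_n ∈ K[x_1..x_n]`); the closure of a field-parametric class `𝒞` is taken, as printed, through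
  `𝒞(F(ε))` with `F(ε) = RatFunc F`: `(f_n) ∈ cl 𝒞(F)` iff for a polynomially bounded `m` some
  `(g_n) ∈ 𝒞(F(ε))` has `g_{m(n)} ∈ F[ε][x_1..x_{m(n)}]` with `g_{m(n)} = f_n + ε · g'` — coefficientwise:
  every coefficient of `g_{m(n)}` is a POLYNOMIAL in `ε` whose constant term is the corresponding
  coefficient of `f_n` (padded by zero to `m(n)` variables) (`MS2021.IsEpsApprox`, `MS2021.closure`).
  `ΣΠΣ(F)` as a class of families = families computed by `Σ^{[s]}Π^{[d]}Σ` circuits (Def 4) with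
  `s`, `d` polynomially bounded (`MS2021.SPSClass`; the paper uses the class without displaying this
  sentence — standard reading, disclosed). Thm 42's clause "for fields of size `|F| ≥ n+1`" in a
  statement about classes of families is typed for INFINITE `F`.
* FACT-LIST marks: `-- FACT` (published, unproved here; `def … : Prop`, never asserted),
  `-- PROVED` (definitions). No `instance`, no `notation` is introduced (Mathlib's
  matrix literal syntax `!![…]` is only USED).

§1.2.2 is typed PARTIALLY (appended section at the end of the file): Def 5 read-once formulas as the
inductive predicate `MS2021.IsROP` (the tree's `IsPROP` of `ReadOnceFormulas.lean` is the PREPROCESSED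
notion with arbitrary univariate leaves — cited, not reused), Thm 33 (arXiv ‹PITROPINV›) and Cor 34
(arXiv ‹Cor 1.20›); and (second appended section) Def 8 (the canonical ROANF `ANF_Δ`, `MS2021.anf`),
the classes `ROF^{GL}`, `ANF^{GLaff}`, `VP_e` (the last over the tree's fan-in-two `formulaComplexity`,
`CircuitDepth.lean`), Thm 32 (`ANF^{GLaff} ⊊ ROF^{GL} ⊊ VP_e` and the density
`cl ANF^{GLaff} = cl ROF^{GL} = cl VP_e`), Thm 35 and Cor 36. NOT typed (scope): Def 7 (general ANFs —
only the canonical ROANF of Def 8 is needed by the statements), Thm 37 (Gupta–Kayal–Qiao randomized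
reconstruction), Thm 46 (Kayal–Saha reconstruction, randomized algorithm), Rems 38–39/47,
Problems 1, 49–52, §1.3–§1.5 discussion, and the size clauses of Thm 48 ("`ΣΠΣ` formula of size
`t^{O(√t)}`", …: consequences of depth-3 formulas for small determinants, not part of the map's
construction).

v2 (seat x6 g2, 2026-08-26) — CORRECTION OF A TYPING DEFECT (ours, not the paper's). v1 stated the
defining condition of the two classes of families `MS2021.ROFLinClass` (`ROF^{GL}`) and
`MS2021.ANFAffClass` (`ANF^{GLaff}`) at EVERY level `n : ℕ`. At `n = 0` that condition is
unsatisfiable — a read-once formula has at least one leaf, so there is no read-once polynomial in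
`Fin 0` variables, and `4^Δ ≤ 0` is impossible — which made both classes EMPTY and the typed facts
`MS2021_thm_32_incl` (clause `ANF^{GLaff} ≠ ROF^{GL}` read `∅ ≠ ∅`) and `MS2021_thm_32_closure`
(`∅ = cl VP_e`, but the zero family lies in `cl VP_e`) FALSE AS TYPED (kernel evidence: theorems
`not_MS2021_thm_32_incl`, `not_MS2021_thm_32_closure` in the cell's evidence file
`np/evidence/x6g2-MS21Level0Vacuity.lean`, against v1 @ 65939bb14f9b). The paper indexes families
`(f_n)_n`, `f_n ∈ F[x_1, …, x_n]`, by `n ≥ 1`; v2 requires the two conditions for `0 < n` only (the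
level `n = 0`, where `F[x_1..x_0] = F`, is unconstrained, as it implicitly is for `VP_e`, whose
level-`0` members are the constants, of formula size `0`). Nothing else changed: all other
declarations of v1 are byte-identical (the classes `TAffClass`, `SigmaPiAffClass`, `SPSClass`,
`VPeClass` are satisfiable at level `0` and were not affected; the per-level sets `contOrbits K 0`,
`rofAffOrbits K 0` are empty, which only makes the level-`0` instances of the hitting-set
statements trivial).

## References
* [MediniShpilka2021] CCC 2021 LIPIcs 200:19 — Def 9 (p.19:7), Defs 11, 15, 17 (p.19:8), Def 19,
  §1.1.6 (p.19:9), Def 27, Thm 28, Cor 29, Thms 30–31 (p.19:12), Def 40 (p.19:13), Def 41, Thms 42–43,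
  Cor 44, Thm 45 (p.19:14), Thm 48 (p.19:15); arXiv:2102.05632 held text p0005–p0009 (numbers as in
  the crosswalk above).
* [GuoKumarSaptharishiSolomon2019] ‹Def 1› (generators; tree `HittingSets.IsGeneratorFor`).
* K. Bringmann, C. Ikenmeyer, J. Zuiddam, J. ACM 65 (2018), Rem. 3.14 (the continuant), Thm. 3.12.
-/

noncomputable section

open MvPolynomial Matrix

namespace Literature.Computability.AlgebraicComplexity

namespace MS2021

/-! ### §1.1.6: `f(Ax + b)` and orbits under `GL_n(F)`, `GLaff_n(F)` -/

section Orbits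

variable {K : Type*} [Field K] {m n : ℕ}

-- PROVED (definition)
/-- **`f(Ax + b)`** (eq. (2)): for `f ∈ K[x_1..x_m]`, `A ∈ K^{n×n}`, `b ∈ K^n`, `n ≥ m`, the
`n`-variate polynomial `f(Σ_i A_{1,i} x_i + b_1, …, Σ_i A_{m,i} x_i + b_m)` ("Note that we ignored the
last `n - m` coordinates of `Ax + b`").
[cite: MediniShpilka2021, §1.1.6 eq. (2) (CCC p.19:9; arXiv p0007.txt:L7-10)] -/
def affSubst (h : m ≤ n) (A : Matrix (Fin n) (Fin n) K) (b : Fin n → K) (f : MvPolynomial (Fin m) K) :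
    MvPolynomial (Fin n) K :=
  aeval (fun i : Fin m =>
    (∑ j : Fin n, C (A (Fin.castLE h i) j) * X j) + C (b (Fin.castLE h i))) f

-- PROVED (definition)
/-- **The orbit `f^{GLaff_n(K)}`** `= {f(Ax + b) | A ∈ GL_n(K), b ∈ K^n}` of an `m`-variate `f` under the
invertible affine transformations of `K^n`, `n ≥ m` (empty if `n < m`).
[cite: MediniShpilka2021, §1.1.6 (CCC p.19:9 "f^{GLaff_n(F)} ≜ {f(Ax+b) | A ∈ GL_n(F), b ∈ F^n}"; arXiv p0007.txt:L16-18)] -/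
def affOrbit (n : ℕ) (f : MvPolynomial (Fin m) K) : Set (MvPolynomial (Fin n) K) :=
  {g | ∃ (h : m ≤ n) (A : Matrix (Fin n) (Fin n) K) (b : Fin n → K), IsUnit A.det ∧ g = affSubst h A b f}

-- PROVED (definition)
/-- **The orbit `f^{GL_n(K)}`** `= {f(Ax) | A ∈ GL_n(K)}` ("We similarly define `f^{GL_n(F)}`").
[cite: MediniShpilka2021, §1.1.6 (CCC p.19:9; arXiv p0007.txt:L20)] -/
def linOrbit (n : ℕ) (f : MvPolynomial (Fin m) K) : Set (MvPolynomial (Fin n) K) :=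
  {g | ∃ (h : m ≤ n) (A : Matrix (Fin n) (Fin n) K), IsUnit A.det ∧ g = affSubst h A 0 f}

end Orbits

/-! ### Defs 15, 19: interpolating sets; `k`-independent polynomial maps -/

section Maps

variable {K : Type*} [CommSemiring K] {n : ℕ}

-- PROVED (definition)
/-- **Interpolating set** (Def 15 = arXiv ‹Def 1.11›): "`H ⊆ F^n` is called an interpolating set for
`𝒞` if, for every `f ∈ 𝒞`, the evaluations of `f` on `H` uniquely determine `f`."
[cite: MediniShpilka2021, Def 15 (CCC p.19:8; = arXiv ‹Def 1.11› p0006.txt:L38-39)] -/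
def IsInterpolatingSetFor (H : Set (Fin n → K)) (𝒞 : Set (MvPolynomial (Fin n) K)) : Prop :=
  ∀ f ∈ 𝒞, ∀ g ∈ 𝒞, (∀ a ∈ H, eval a f = eval a g) → f = g

variable {t : ℕ}

-- PROVED (definition)
/-- **`1`-independent polynomial map** (Def 19 = arXiv ‹Def 1.15›): "`G(y_1, …, y_t, z_1) : F^{t+1} →
F^n` [is] a `1`-independent polynomial map if for every index `i ∈ [n]` there exists an assignment
`a_i ∈ F^t` to `y_1, …, y_t` such that the `i`th coordinate of `G(a_i, z_1)` is `z_1`, and the rest of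
the coordinates are `0`." Variables: `Sum.inl s` = `y_s`, `Sum.inr ()` = `z_1`; the partial
substitution `y := a` lands in `K[z_1]`.
[cite: MediniShpilka2021, Def 19 (CCC p.19:9; = arXiv ‹Def 1.15› p0006.txt:L64-65)] -/
def IsOneIndependent (G : Fin n → MvPolynomial (Fin t ⊕ Unit) K) : Prop :=
  ∀ i : Fin n, ∃ a : Fin t → K, ∀ j : Fin n,
    aeval (Sum.elim (fun s => C (a s)) (fun _ => X ()) : Fin t ⊕ Unit → MvPolynomial Unit K) (G j) =
      if j = i then X () else 0

-- PROVED (definition)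
/-- **`k`-independent polynomial map** (Def 19): "`G(y_1, …, y_{tk}, z_1, …, z_k) : F^{k(t+1)} → F^n`
is called a `k`-independent polynomial map if `G` is a sum of `k` variable-disjoint `1`-independent
polynomial maps" — block `l < k` uses the variables `(l, ·)`.
[cite: MediniShpilka2021, Def 19 (CCC p.19:9; = arXiv ‹Def 1.15› p0006.txt:L65)] -/
def IsIndependent (k : ℕ) (G : Fin n → MvPolynomial (Fin k × (Fin t ⊕ Unit)) K) : Prop :=
  ∃ Gs : Fin k → Fin n → MvPolynomial (Fin t ⊕ Unit) K, (∀ l, IsOneIndependent (Gs l)) ∧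
    ∀ j, G j = ∑ l : Fin k, rename (Prod.mk l) (Gs l j)

-- PROVED (definition)
/-- **Uniform** map: "all `n` coordinates of `G` are homogeneous polynomials of the same degree"
(Def 19). [cite: MediniShpilka2021, Def 19 (CCC p.19:9; = arXiv ‹Def 1.15› p0006.txt:L67)] -/
def IsUniform {σ : Type*} (G : Fin n → MvPolynomial σ K) : Prop :=
  ∃ e : ℕ, ∀ j, (G j).IsHomogeneous e

end Maps

/-! ### Def 27 (the continuant), Def 40 (`T_{s,d}`), Def 4 (`Σ^{[s]}Π^{[d]}Σ`), sparse orbits -/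

section Classes

variable (K : Type*) [Field K]

-- PROVED (definition)
/-- **The continuant polynomial** (Def 27 = arXiv ‹Def 1.16›; Bringmann–Ikenmeyer–Zuiddam Rem. 3.14):
`C_n(x_1, …, x_n) ≜ Trace((x_1 1; 1 0) · (x_2 1; 1 0) ⋯ (x_n 1; 1 0))` (so `C_1 = x_1`,
`C_2 = x_1 x_2 + 2`, `C_0 = 2`; `C_1 = X 0` was checked by `simp [cont, Matrix.trace, Fin.sum_univ_two]`
while typing). [cite: MediniShpilka2021, Def 27 (CCC p.19:12 eq. (3); = arXiv ‹Def 1.16› p0007.txt:L35-57)] -/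
def cont (n : ℕ) : MvPolynomial (Fin n) K :=
  Matrix.trace ((List.ofFn fun i : Fin n =>
    (!![X i, 1; 1, 0] : Matrix (Fin 2) (Fin 2) (MvPolynomial (Fin n) K))).prod)

-- PROVED (definition)
/-- `⋃_{m=1}^{n} C_m^{GLaff_n(K)}`: the `n`-variate members of the class `C^{GLaff}(K)` ("families `(f_n)`
such that `f_n ∈ F[x_1..x_n]` and for some `m ≤ n`, `f_n ∈ C_m^{GLaff_n(F)}`"), the class of Thm 30.
[cite: MediniShpilka2021, Def 27 and Thm 30 (CCC p.19:12; = arXiv ‹Def 1.16›/‹Thm 1.18› p0007.txt:L59-60, L80-81)] -/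
def contOrbits (n : ℕ) : Set (MvPolynomial (Fin n) K) :=
  {f | ∃ m, 1 ≤ m ∧ m ≤ n ∧ f ∈ affOrbit n (cont K m)}

-- PROVED (definition)
/-- **The canonical diagonal tensor** (Def 40 = arXiv ‹Def 1.24›): `T_{s,d} ≜ Σ_{i=1}^{s} ∏_{j=1}^{d}
x_{i,j}`, "a sum of `s` variable-disjoint monomials", as a polynomial in the `s·d` numbered variables
`x_{i,j} ↦ finProdFinEquiv (i, j)` (so that `GLaff_n`, `n ≥ s·d`, acts).
[cite: MediniShpilka2021, Def 40 (CCC p.19:13; = arXiv ‹Def 1.24› p0008.txt:L51-53)] -/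
def sdm (s d : ℕ) : MvPolynomial (Fin (s * d)) K :=
  ∑ i : Fin s, ∏ j : Fin d, X (finProdFinEquiv (i, j))

variable {K}

-- PROVED (definition)
/-- **`Σ^{[s]}Π^{[d]}Σ` circuits** (Def 4 = arXiv ‹Def 1.4›): they "compute polynomials of the form
`f(x) = Σ_{i=1}^{s} ∏_{j=1}^{d} (α_{i,j,0} + Σ_{k=1}^{n} α_{i,j,k} x_k)`" (fan-ins `≤ s`, `≤ d`; padding
with the constant forms `1` and `0` makes "exactly `s`, `d`" equivalent).
[cite: MediniShpilka2021, Def 4 (CCC p.19:6; = arXiv ‹Def 1.4› p0005.txt:L25-30)] -/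
def IsSPS {n : ℕ} (s d : ℕ) (f : MvPolynomial (Fin n) K) : Prop :=
  ∃ α : Fin s → Fin d → Option (Fin n) → K,
    f = ∑ i : Fin s, ∏ j : Fin d, (C (α i j none) + ∑ k : Fin n, C (α i j (some k)) * X k)

-- PROVED (definition)
/-- `(Σ^{[s]}Π^{[d]})^{GLaff_n(K)}`: orbits of polynomials with at most `s` monomials and degree `≤ d`
in `m ≤ n` variables (Def 3: "`Σ^{[s]}Π^{[d]}` compute polynomials of degree `d` with at most `s`
monomials"), the class of Cor 44. [cite: MediniShpilka2021, Def 3 and Cor 44 (CCC p.19:6, 19:14; = arXiv ‹Def 1.3›, ‹Cor 1.27› p0009.txt:L4-6)] -/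
def sparseAffOrbits (n s d : ℕ) : Set (MvPolynomial (Fin n) K) :=
  {f | ∃ (m : ℕ) (g : MvPolynomial (Fin m) K), g.support.card ≤ s ∧ g.totalDegree ≤ d ∧
    f ∈ affOrbit n g}

end Classes

/-! ### Def 9 (closure via `F(ε)`) and the three classes of families of Thm 42 -/

section Families

variable (K : Type*) [Field K]

-- PROVED (definition)
/-- **`T^{GLaff}(K)`** (Def 40): families `(f_n)` with, for every `n`, some `s, d` with `n ≥ s·d` and
`f_n ∈ T_{s,d}^{GLaff_n(K)}`. [cite: MediniShpilka2021, Def 40 (CCC p.19:13; = arXiv ‹Def 1.24› p0008.txt:L53-55)] -/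
def TAffClass : Set (∀ n, MvPolynomial (Fin n) K) :=
  {f | ∀ n, ∃ s d : ℕ, s * d ≤ n ∧ f n ∈ affOrbit n (sdm K s d)}

-- PROVED (definition)
/-- **`ΣΠ^{GLaff}(K)`** (Def 41): "all families `(f_n)`, of polynomially bounded degree, such that for
some polynomially bounded `m(n)`, there exist `Σ^{m(n)}Π^{deg(f_n)}` circuits `Φ_m`, in `k ≤ n` many
variables, such that `f_n ∈ Φ_m^{GLaff_n(F)}`" ("polynomially bounded" = tree `IsPBounded`).
[cite: MediniShpilka2021, Def 41 (CCC p.19:14; = arXiv ‹Def 1.25› p0008.txt:L58-60)] -/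
def SigmaPiAffClass : Set (∀ n, MvPolynomial (Fin n) K) :=
  {f | IsPBounded (fun n => (f n).totalDegree) ∧ ∃ m : ℕ → ℕ, IsPBounded m ∧
    ∀ n, ∃ (k : ℕ) (g : MvPolynomial (Fin k) K), k ≤ n ∧ g.support.card ≤ m n ∧
      g.totalDegree ≤ (f n).totalDegree ∧ f n ∈ affOrbit n g}

-- PROVED (definition)
/-- **`ΣΠΣ(K)`** as a class of families: `f_n` computed by a `Σ^{[s(n)]}Π^{[d(n)]}Σ` circuit (Def 4)
with `s`, `d` polynomially bounded (standard reading of the class symbol, see module docstring).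
[cite: MediniShpilka2021, Def 4 and Thm 42 (CCC p.19:6, 19:14; = arXiv ‹Def 1.4›, ‹Thm 1.26›)] -/
def SPSClass : Set (∀ n, MvPolynomial (Fin n) K) :=
  {f | ∃ s d : ℕ → ℕ, IsPBounded s ∧ IsPBounded d ∧ ∀ n, IsSPS (s n) (d n) (f n)}

variable {K}

-- PROVED (definition)
/-- **`g = f + O(ε)`** (Def 9, eq. (1)): `g ∈ K[ε][x_1..x_M]` (coefficients POLYNOMIAL in `ε`, inside
`K(ε) = RatFunc K`) approximates `f ∈ K[x_1..x_n]`, `n ≤ M`: every coefficient of `g` is (the image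
of) a polynomial in `ε` whose constant term is the corresponding coefficient of `f` padded by zero to
`M` variables — "`g_{m(n)}(x_1..x_{m(n)}) = f_n(x_1..x_n) + ε · g_{n,0}(x_1..x_{m(n)})`".
[cite: MediniShpilka2021, Def 9 eq. (1) (CCC p.19:7; = arXiv ‹Def 1.5› p0005.txt:L36-42)] -/
def IsEpsApprox {n M : ℕ} (f : MvPolynomial (Fin n) K) (g : MvPolynomial (Fin M) (RatFunc K)) : Prop :=
  ∃ h : n ≤ M, ∀ e : Fin M →₀ ℕ, ∃ p : Polynomial K,
    coeff e g = algebraMap (Polynomial K) (RatFunc K) p ∧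
      p.coeff 0 = coeff e (rename (Fin.castLE h) f)

-- PROVED (definition)
/-- **The closure `cl 𝒞(K)`** of a class (Def 9): "`(f_n) ∈ cl 𝒞(F)` if there is a polynomially
bounded function `m : ℕ → ℕ`, and a family `(g_{m(n)})_n ∈ 𝒞(F(ε))`, with
`g_{m(n)} ∈ F[ε][x_1..x_{m(n)}]`, such that for all `n`, `g_{m(n)} = f_n + ε · g_{n,0}`." The class is
supplied already evaluated at `F(ε) = RatFunc K` (`𝒞ε`).
[cite: MediniShpilka2021, Def 9 (CCC p.19:7; = arXiv ‹Def 1.5› p0005.txt:L36-42)] -/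
def closure (𝒞ε : Set (∀ n, MvPolynomial (Fin n) (RatFunc K))) : Set (∀ n, MvPolynomial (Fin n) K) :=
  {f | ∃ m : ℕ → ℕ, IsPBounded m ∧ ∃ g ∈ 𝒞ε, ∀ n, IsEpsApprox (f n) (g (m n))}

end Families

end MS2021

/-! ### §1.2.1 The continuant orbit: Thm 28, Cor 29, Thm 30 (Thm 31 NOT typed) -/

section Continuant

open MS2021 HittingSets

-- FACT
/-- **MS Thm 28 (arXiv ‹thmhitcont›).** "Let `f(x_1, …, x_n) ∈ C_m^{GLaff_n(F)}`, for `m ≤ n`, and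
arbitrary `F`. Then, for any uniform `1`-independent polynomial map `G` over `F`, `f ∘ G ≠ 0`."
(Continuants `C_m`, `1 ≤ m ≤ n`; `G : F^{t+1} → F^n` for any `t`.)
[cite: MediniShpilka2021, Thm 28 (CCC p.19:12; = arXiv unnumbered ‹thmhitcont› p0007.txt:L72-73)] -/
def MS2021_thm_28 : Prop :=
  ∀ (K : Type) [Field K] (n m t : ℕ), 1 ≤ m → m ≤ n → ∀ f ∈ affOrbit n (cont K m),
    ∀ G : Fin n → MvPolynomial (Fin 1 × (Fin t ⊕ Unit)) K, IsIndependent 1 G → IsUniform G →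
      bind₁ G f ≠ 0

-- FACT (existence and size only; "explicit" dropped — WEAKER; large-field case)
/-- **MS Cor 29 (arXiv ‹Cor 1.17›).** "For every field `F`, there is an explicit hitting set `H ⊂ F^n`,
of size `|H| = O(n⁶)`, that hits every `0 ≠ f ∈ C_m^{GLaff_n(F)}`. If `|F| < n²` then `H` is defined over
a polynomial-sized extension field …". Typed: one constant `c` such that over every field with
`|F| ≥ n²` (or infinite) there is a set of `≤ c·n⁶` points hitting `⋃_{1 ≤ m ≤ n} C_m^{GLaff_n}`.
[cite: MediniShpilka2021, Cor 29 (CCC p.19:12; = arXiv ‹Cor 1.17› p0007.txt:L77-78)] -/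
def MS2021_cor_29 : Prop :=
  ∃ c : ℕ, ∀ (K : Type) [Field K] (n : ℕ), (Infinite K ∨ n ^ 2 ≤ Nat.card K) →
    ∃ H : Finset (Fin n → K), H.card ≤ c * n ^ 6 ∧ IsHittingSetFor (↑H) (contOrbits K n)

-- FACT (existence and size only; "explicit" dropped — WEAKER; large-field case)
/-- **MS Thm 30 (arXiv ‹Thm 1.18›).** "For every field `F`, there is an explicit interpolating set
`H ⊂ F^n`, of size `|H| = O(n^{10})`, for `⋃_{m=1}^{n} C_m^{GLaff_n(F)}`. If `|F| < n²` then `H` is defined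
over a polynomial-sized extension field of `F`, `K` such that `|K| ≥ n²`." Typed: one constant `c`;
over every field with `|F| ≥ n²` (or infinite) an interpolating set of `≤ c·n^{10}` points exists.
[cite: MediniShpilka2021, Thm 30 (CCC p.19:12; = arXiv ‹Thm 1.18› p0007.txt:L80-81)] -/
def MS2021_thm_30 : Prop :=
  ∃ c : ℕ, ∀ (K : Type) [Field K] (n : ℕ), (Infinite K ∨ n ^ 2 ≤ Nat.card K) →
    ∃ H : Finset (Fin n → K), H.card ≤ c * n ^ 10 ∧ IsInterpolatingSetFor (↑H) (contOrbits K n)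

end Continuant

/-! ### §1.2.3 Dense subclasses of `ΣΠΣ`: Thm 42, Thm 43, Cor 44, Thm 45 -/

section SigmaPiSigma

open MS2021 HittingSets

-- FACT
/-- **MS Thm 42 (arXiv ‹Thm 1.26›), inclusions.** "For every field `F` it holds that
`T^{GLaff}(F) ⊊ ΣΠ^{GLaff}(F) ⊆ ΣΠΣ(F)`" — the two inclusions and the strictness of the first.
[cite: MediniShpilka2021, Thm 42 (CCC p.19:14; = arXiv ‹Thm 1.26› p0008.txt:L63-68)] -/
def MS2021_thm_42_incl : Prop :=
  ∀ (K : Type) [Field K], TAffClass K ⊆ SigmaPiAffClass K ∧ TAffClass K ≠ SigmaPiAffClass K ∧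
    SigmaPiAffClass K ⊆ SPSClass K

-- FACT (typed for infinite fields — print: "for fields of size |F| ≥ n + 1")
/-- **MS Thm 42, strictness of the second inclusion.** "and for fields of size `|F| ≥ n + 1`,
`ΣΠ^{GLaff}(F) ⊊ ΣΠΣ(F)`." Typed for infinite `F` (the clause ranges over all `n`).
[cite: MediniShpilka2021, Thm 42 (CCC p.19:14; = arXiv ‹Thm 1.26› p0008.txt:L70-72)] -/
def MS2021_thm_42_strict : Prop :=
  ∀ (K : Type) [Field K] [Infinite K], SigmaPiAffClass K ≠ SPSClass K

-- FACT (the density statement)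
/-- **MS Thm 42, closures** (eq. (7)): "In addition, `cl T^{GLaff}(F) = cl ΣΠ^{GLaff}(F) = cl ΣΠΣ(F)`" —
the orbits of diagonal tensors are DENSE in `ΣΠΣ` (closure of Def 9, through `F(ε)`).
[cite: MediniShpilka2021, Thm 42 eq. (7) (CCC p.19:14; = arXiv ‹Thm 1.26› eq. after "In addition" p0008.txt:L74-78)] -/
def MS2021_thm_42_closure : Prop :=
  ∀ (K : Type) [Field K],
    closure (TAffClass (RatFunc K)) = closure (SigmaPiAffClass (RatFunc K)) ∧
    closure (SigmaPiAffClass (RatFunc K)) = closure (SPSClass (RatFunc K))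

-- FACT
/-- **MS Thm 43 (arXiv ‹PITSINV›).** "Let `0 ≠ g ∈ F[x]` have sparsity `≤ 2^t`. Let `(A, b) ∈ GLaff_n(F)`,
and `f(x) = g(Ax + b)`. Then, for any `(t+1)`-independent polynomial map `G`, `f ∘ G ≠ 0`." (`g` in
`m ≤ n` variables; `G` with any number of control variables per block.)
[cite: MediniShpilka2021, Thm 43 (CCC p.19:14; = arXiv unnumbered ‹PITSINV› p0009.txt:L1-2)] -/
def MS2021_thm_43 : Prop :=
  ∀ (K : Type) [Field K] (n m t c : ℕ) (g : MvPolynomial (Fin m) K), g ≠ 0 → g.support.card ≤ 2 ^ t →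
    ∀ f ∈ affOrbit n g, ∀ G : Fin n → MvPolynomial (Fin (t + 1) × (Fin c ⊕ Unit)) K,
      IsIndependent (t + 1) G → bind₁ G f ≠ 0

-- FACT (existence and size only; "explicit" dropped — WEAKER; large-field case)
/-- **MS Cor 44 (arXiv ‹Cor 1.27›).** "For any integers `s, d, n`, there exists an explicit hitting set
`H ⊂ F^n`, of size `|H| = (nd)^{O(log s)}`, such that `H` hits every nonzero polynomial
`f ∈ (Σ^{[s]}Π^{[d]})^{GLaff_n(F)}`. If `|F| ≤ n·d` then we let `H` be defined over an extension field `K`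
of `F` of size `|K| > n·d`." Typed: one constant `c`; for `|F| > n·d` (or infinite) a set of at most
`(n·d)^{c (⌊log₂ s⌋ + 1)} + c` points hits the orbits of `s`-sparse degree-`≤ d` polynomials.
[cite: MediniShpilka2021, Cor 44 (CCC p.19:14; = arXiv ‹Cor 1.27› p0009.txt:L4-5)] -/
def MS2021_cor_44 : Prop :=
  ∃ c : ℕ, ∀ (K : Type) [Field K] (s d n : ℕ), (Infinite K ∨ n * d < Nat.card K) →
    ∃ H : Finset (Fin n → K), H.card ≤ (n * d) ^ (c * (Nat.log 2 s + 1)) + c ∧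
      IsHittingSetFor (↑H) (sparseAffOrbits (K := K) n s d)

-- FACT
/-- **MS Thm 45 (arXiv ‹PITsumSDMinv›).** "Let `n, s_1, s_2, d_1, d_2 ∈ ℕ` be such that
`n ≥ s_1·d_1, s_2·d_2`. For `i ∈ {1, 2}` let `f_i ∈ T_{s_i,d_i}^{GL_n(F)}`, and let `f = f_1 - f_2`. If
`f ≠ 0`, then any uniform `6`-independent polynomial map `G` satisfies `f ∘ G ≠ 0`." (LINEAR orbits
`GL_n`, as printed.) [cite: MediniShpilka2021, Thm 45 (CCC p.19:14; = arXiv unnumbered ‹PITsumSDMinv› p0009.txt:L9-12)] -/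
def MS2021_thm_45 : Prop :=
  ∀ (K : Type) [Field K] (n s₁ s₂ d₁ d₂ c : ℕ), s₁ * d₁ ≤ n → s₂ * d₂ ≤ n →
    ∀ f₁ ∈ linOrbit n (sdm K s₁ d₁), ∀ f₂ ∈ linOrbit n (sdm K s₂ d₂), f₁ - f₂ ≠ 0 →
      ∀ G : Fin n → MvPolynomial (Fin 6 × (Fin c ⊕ Unit)) K, IsIndependent 6 G → IsUniform G →
        bind₁ G (f₁ - f₂) ≠ 0

end SigmaPiSigma

/-! ### §1.2.4 Robust hitting sets? — Thm 48: independent maps are not robust -/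

section Robust

open MS2021

-- FACT (the construction = Forbes–Saptharishi–Tzameret–Wigderson, Construction 6.3)
/-- **MS Thm 48 (arXiv ‹Thm 1.29›), the map and its annihilators.** "Let `F` be of characteristic zero.
For every `t`, there exists a uniform `t`-independent polynomial map `G` and a nonzero polynomial `f`
such that `f ∘ G ≡ 0` […]. Furthermore, for a certain arrangement of the variables in a `√n × √n`
matrix, `f` can be taken to be the determinant of any `(t+1) × (t+1)` minor." Typed: for every
`t ≥ 1` there are `n = r²` with `r ≥ t + 1`, an arrangement `e : Fin r × Fin r ≃ Fin n`, and a uniform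
`t`-independent `G : F^{t(c+1)} → F^n` annihilating the determinant of EVERY `(t+1) × (t+1)` minor of
the variable matrix `(x_{e(i,j)})` (each of which is a nonzero polynomial). The size clauses ("`ΣΠΣ`
formula of size `t^{O(√t)}`", "`t^t`", "`t^{O(log t)}`") are not typed.
[cite: MediniShpilka2021, Thm 48 (CCC p.19:15; = arXiv ‹Thm 1.29› p0009.txt:L28-29)] -/
def MS2021_thm_48 : Prop :=
  ∀ (K : Type) [Field K] [CharZero K] (t : ℕ), 1 ≤ t →
    ∃ (r c : ℕ) (e : Fin r × Fin r ≃ Fin (r * r)) (G : Fin (r * r) → MvPolynomial (Fin t × (Fin c ⊕ Unit)) K),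
      t + 1 ≤ r ∧ IsIndependent t G ∧ IsUniform G ∧
      ∀ (rows cols : Fin (t + 1) ↪ Fin r),
        bind₁ G (Matrix.det (Matrix.of fun i j : Fin (t + 1) =>
          (X (e (rows i, cols j)) : MvPolynomial (Fin (r * r)) K))) = 0

end Robust

/-! ### §1.2.2 (partial): Def 5 read-once formulas, Thm 33, Cor 34 (orbits of read-once formulas) -/

namespace MS2021

section ReadOnce

variable {K : Type*} [CommSemiring K] {σ : Type*} [DecidableEq σ]

-- PROVED (definition)
/-- **Read-once polynomials with their leaf sets** (Def 5 = arXiv (def:ROF)):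
"An arithmetic read-once formula (ROF) `Φ` over a field `F` in the variables `x = (x_1, …, x_n)` is a
binary tree whose leaves are labeled with input variables and a pair of field elements
`(α, β) ∈ F²`, and whose internal nodes are labeled with the arithmetic operations `{+, ×}` and a
field element `α ∈ F`. Each input variable can label at most one leaf. … A leaf labeled with the
variable `x_i` and with `(α, β)` computes the polynomial `α x_i + β`. If a node `v` is labeled with the
operation `∗ ∈ {+, ×}` and with `α ∈ F`, and its children compute the polynomials `Φ_{v_1}` and
`Φ_{v_2}`, then the polynomial computed at `v` is `Φ_v = Φ_{v_1} ∗ Φ_{v_2} + α`." `IsROP S f`: `f` is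
computed by a ROF whose leaves carry exactly the variables of `S` (disjoint unions at internal
nodes render "each input variable can label at most one leaf"). (The tree's `IsPROP` of
`ReadOnceFormulas.lean` is the PREPROCESSED notion with arbitrary univariate leaves; cited, not reused.)
[cite: MediniShpilka2021, Def 5 (CCC p.19:6; the arXiv text defines ROFs later as (def:ROF), announced at p0007.txt:L91)] -/
inductive IsROP : Finset σ → MvPolynomial σ K → Prop
  | leaf (i : σ) (α β : K) : IsROP {i} (C α * X i + C β)
  | add {S₁ S₂ : Finset σ} {f g : MvPolynomial σ K} (α : K) :
      IsROP S₁ f → IsROP S₂ g → Disjoint S₁ S₂ → IsROP (S₁ ∪ S₂) (f + g + C α)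
  | mul {S₁ S₂ : Finset σ} {f g : MvPolynomial σ K} (α : K) :
      IsROP S₁ f → IsROP S₂ g → Disjoint S₁ S₂ → IsROP (S₁ ∪ S₂) (f * g + C α)

end ReadOnce

-- PROVED (definition)
/-- `ROF^{GLaff_n(K)}` at level `n`: affine orbits of read-once polynomials in `m ≤ n` variables
("there exists a ROF `Φ`, on `m ≤ n` variables, such that `f_n ∈ Φ^{GLaff_n(F)}`"; Thm 33 / Cor 34 use
the affine orbit). [cite: MediniShpilka2021, §1.2.2 (CCC p.19:12; = arXiv p0007.txt:L91)] -/
def rofAffOrbits (K : Type*) [Field K] (n : ℕ) : Set (MvPolynomial (Fin n) K) :=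
  {f | ∃ (m : ℕ) (S : Finset (Fin m)) (g : MvPolynomial (Fin m) K), IsROP S g ∧ f ∈ affOrbit n g}

end MS2021

section ReadOnceOrbits

open MS2021 HittingSets

-- FACT
/-- **MS Thm 33 (arXiv ‹PITROPINV›).** "Let `0 ≠ f ∈ ROF^{GLaff_n(F)}` where the underlying ROF depends
on `2^t` variables, for `2^t ≤ n`. Then, for any `(t+1)`-independent polynomial map `G`, over `F`,
`f ∘ G ≠ 0`." Typed literally with a ROF whose leaf set has exactly `2^t` variables (of `m ≤ n`).
[cite: MediniShpilka2021, Thm 33 (CCC p.19:13; = arXiv unnumbered ‹PITROPINV› p0008.txt:L20-22)] -/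
def MS2021_thm_33 : Prop :=
  ∀ (K : Type) [Field K] (n m t c : ℕ) (S : Finset (Fin m)) (g : MvPolynomial (Fin m) K),
    IsROP S g → S.card = 2 ^ t → 2 ^ t ≤ n → ∀ f ∈ affOrbit n g, f ≠ 0 →
      ∀ G : Fin n → MvPolynomial (Fin (t + 1) × (Fin c ⊕ Unit)) K, IsIndependent (t + 1) G →
        bind₁ G f ≠ 0

-- FACT (existence and size only; large-field case)
/-- **MS Cor 34 (arXiv ‹Cor 1.20›).** "For every field `F`, there is a hitting set `H ⊂ F^n`, of size
`|H| = n^{O(log n)}`, that hits every `0 ≠ f ∈ ROF^{GLaff_n(F)}`. If `|F| < n²` then `H` is defined over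
a polynomial-sized extension field of `F`, `K` such that `|K| ≥ n²`." Typed: one constant `c`; for
`|F| ≥ n²` (or infinite) a set of at most `n^{c (⌊log₂ n⌋ + 1)} + c` points hits the affine orbits of
all read-once polynomials in `≤ n` variables.
[cite: MediniShpilka2021, Cor 34 (CCC p.19:13; = arXiv ‹Cor 1.20› p0008.txt:L24-25)] -/
def MS2021_cor_34 : Prop :=
  ∃ c : ℕ, ∀ (K : Type) [Field K] (n : ℕ), (Infinite K ∨ n ^ 2 ≤ Nat.card K) →
    ∃ H : Finset (Fin n → K), H.card ≤ n ^ (c * (Nat.log 2 n + 1)) + c ∧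
      IsHittingSetFor (↑H) (rofAffOrbits K n)

end ReadOnceOrbits

/-! ### §1.2.2 (continued): Def 8 (the canonical ROANF `ANF_Δ`), the classes `ROF^{GL}`, `ANF^{GLaff}`,
`VP_e`, Thm 32 (density in `VP_e`), Thm 35, Cor 36 -/

namespace MS2021

section ANF

variable (K : Type*) [CommSemiring K]

-- PROVED (definition)
/-- Block embedding `x^{(i)}`: the `j`-th variable of block `i ∈ {0,1,2,3}` among `4^{Δ+1} = 4 · 4^Δ`
variables, i.e. the index `j + 4^Δ · i` ("`x^{(i)}` is the `4^Δ`-tuple of variables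
`{x_{(i-1)·4^Δ+1}, …, x_{i·4^Δ}}`"; Mathlib `finProdFinEquiv (i, j) = j + 4^Δ · i`).
[cite: MediniShpilka2021, Def 8 (CCC p.19:7)] -/
def anfBlock (Δ : ℕ) (i : Fin 4) (j : Fin (4 ^ Δ)) : Fin (4 ^ (Δ + 1)) :=
  Fin.cast (pow_succ' 4 Δ).symm (finProdFinEquiv (i, j))

-- PROVED (definition)
/-- **The canonical ROANF polynomial `ANF_Δ`** on `4^Δ` variables (Def 8 = [GKQ14, Fact 3.4]):
"`ANF_0(x) = x_1`, `ANF_{Δ+1}(x) = ANF_Δ(x^{(1)}) · ANF_Δ(x^{(2)}) + ANF_Δ(x^{(3)}) · ANF_Δ(x^{(4)})`",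
e.g. `ANF_1(x) = x_1 x_2 + x_3 x_4` (here variables are numbered from `0`).
[cite: MediniShpilka2021, Def 8 (CCC p.19:7; arXiv (defCroanf))] -/
def anf : (Δ : ℕ) → MvPolynomial (Fin (4 ^ Δ)) K
  | 0 => X ⟨0, by norm_num⟩
  | Δ + 1 =>
      rename (anfBlock Δ 0) (anf Δ) * rename (anfBlock Δ 1) (anf Δ) +
        rename (anfBlock Δ 2) (anf Δ) * rename (anfBlock Δ 3) (anf Δ)

end ANF

section ClassesVPe

variable (K : Type*) [Field K]

-- PROVED (definition)
/-- **`ROF^{GL}(K)`**: "the class of families of polynomials `(f_n)_n`, such that for every `n` there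
exists a ROF `Φ`, on `m ≤ n` variables, such that `f_n(x_1, …, x_n) ∈ Φ^{GL_n(F)}`" (LINEAR orbits, as
printed). Families are indexed by `n ≥ 1` in print: the condition is required for `0 < n` (v2
correction — v1 required it at `n = 0` too, where no read-once formula exists, making the class
empty; see the module docstring). [cite: MediniShpilka2021, §1.2.2 (CCC p.19:12; arXiv p0007.txt:L91)] -/
def ROFLinClass : Set (∀ n, MvPolynomial (Fin n) K) :=
  {f | ∀ n, 0 < n → ∃ (m : ℕ) (S : Finset (Fin m)) (g : MvPolynomial (Fin m) K),
    m ≤ n ∧ IsROP S g ∧ f n ∈ linOrbit n g}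

-- PROVED (definition)
/-- **`ANF^{GLaff}(K)`**: "the class of families `(f_n)_n`, such that for every `n` there exists `Δ`
such that `4^Δ ≤ n` and `f_n(x_1, …, x_n) ∈ ANF_Δ^{GLaff_n(F)}`". Families are indexed by `n ≥ 1` in
print: the condition is required for `0 < n` (v2 correction — v1 required it at `n = 0` too, where
`4^Δ ≤ 0` fails, making the class empty; see the module docstring).
[cite: MediniShpilka2021, §1.2.2 (CCC p.19:12-13; arXiv p0008.txt:L1)] -/
def ANFAffClass : Set (∀ n, MvPolynomial (Fin n) K) :=
  {f | ∀ n, 0 < n → ∃ Δ : ℕ, 4 ^ Δ ≤ n ∧ f n ∈ affOrbit n (anf K Δ)}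

-- PROVED (definition)
/-- **`VP_e(K)`** (Def 2): "the set of all families of polynomials `(f_n)_n`, with
`f_n ∈ F[x_1, …, x_n]`, whose formula size is polynomially bounded" — formula size = the tree's
fan-in-two `formulaComplexity` (`CircuitDepth.lean`; the paper counts wires — a constant factor,
invisible to polynomial boundedness). [cite: MediniShpilka2021, Def 2 (CCC p.19:5-6; = arXiv ‹Def 1.2› p0005.txt:L15-20)] -/
def VPeClass : Set (∀ n, MvPolynomial (Fin n) K) :=
  {f | IsPBounded fun n => formulaComplexity (f n)}

end ClassesVPe

end MS2021

section ReadOnceDensity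

open MS2021 HittingSets

-- FACT
/-- **MS Thm 32 (arXiv ‹theoremROANFisDense›), inclusions (eq. (5)).** "For every field `F`, it holds
that `ANF^{GLaff}(F) ⊊ ROF^{GL}(F) ⊊ VP_e(F)`." (Over the v2-corrected classes `ANFAffClass`,
`ROFLinClass` — conditions at levels `n ≥ 1`; with the v1 classes this statement was false as
typed, `∅ ≠ ∅`, see the module docstring. Printed proof, arXiv p0026.txt:L4-L7: "obvious" first
inclusion; degrees in `ANF^{GLaff}` are powers of `2`; members of `ROF^{GL}` are multilinear in some
basis, "as the example `f(x) = x²` shows".)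
[cite: MediniShpilka2021, Thm 32 eq. (5) (CCC p.19:12; = arXiv unnumbered ‹theoremROANFisDense› p0008.txt:L4-10)] -/
def MS2021_thm_32_incl : Prop :=
  ∀ (K : Type) [Field K], ANFAffClass K ⊆ ROFLinClass K ∧ ANFAffClass K ≠ ROFLinClass K ∧
    ROFLinClass K ⊆ VPeClass K ∧ ROFLinClass K ≠ VPeClass K

-- FACT (density: orbits of read-once formulas, indeed of the canonical ROANFs, are dense in `VP_e`)
/-- **MS Thm 32, closures (eq. (6)).** "However, when taking closures we get
`cl ANF^{GLaff}(F) = cl ROF^{GL}(F) = cl VP_e(F)`" (closure of Def 9 through `F(ε)`; over the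
v2-corrected classes — with the v1 classes this read `∅ = ∅ = cl VP_e`, false as typed, see the
module docstring. Printed proof, arXiv p0026.txt:L17-L19: Gupta–Kayal–Qiao Prop 3.2, every size-`s`
formula has an ANF formula of size `O(s⁴)`, whose leaf linear forms are then approximated by
linearly independent ones.)
[cite: MediniShpilka2021, Thm 32 eq. (6) (CCC p.19:12; = arXiv ‹theoremROANFisDense› p0008.txt:L12-16)] -/
def MS2021_thm_32_closure : Prop :=
  ∀ (K : Type) [Field K],
    closure (ANFAffClass (RatFunc K)) = closure (ROFLinClass (RatFunc K)) ∧
    closure (ROFLinClass (RatFunc K)) = closure (VPeClass (RatFunc K))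

-- FACT
/-- **MS Thm 35 (arXiv ‹pitSumOfRoanfThm›).** "Let `f_1 = ANF_{Δ_1}(A_1 x + b_1)`,
`f_2 = ANF_{Δ_2}(A_2 x + b_2) ∈ ANF^{GLaff_n(F)}` and `f = f_1 - f_2`. Set `k ≜ 2 max{Δ_1, Δ_2} + 7` and
let `G` be any uniform `k`-independent polynomial map, over `F`. If `f ≠ 0` then `f ∘ G ≠ 0`."
[cite: MediniShpilka2021, Thm 35 (CCC p.19:13; = arXiv unnumbered ‹pitSumOfRoanfThm› p0008.txt:L29-30)] -/
def MS2021_thm_35 : Prop :=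
  ∀ (K : Type) [Field K] (n Δ₁ Δ₂ c : ℕ), ∀ f₁ ∈ affOrbit n (anf K Δ₁), ∀ f₂ ∈ affOrbit n (anf K Δ₂),
    f₁ - f₂ ≠ 0 →
      ∀ G : Fin n → MvPolynomial (Fin (2 * max Δ₁ Δ₂ + 7) × (Fin c ⊕ Unit)) K,
        IsIndependent (2 * max Δ₁ Δ₂ + 7) G → IsUniform G → bind₁ G (f₁ - f₂) ≠ 0

-- FACT (existence and size only; large-field case)
/-- **MS Cor 36 (arXiv ‹Cor 1.21›).** "For any field `F`, the class `ANF_Δ^{GLaff_n(F)}`, for `4^Δ ≤ n`,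
admits an interpolating set `H ⊂ F^n`, of size `|H| = n^{O(Δ)}`. If `|F| < n²` then `H` is defined over
a polynomial-sized extension field of `F`, `K`, such that `|K| ≥ n²`." Typed: one constant `c`; for
`|F| ≥ n²` (or infinite) an interpolating set of at most `n^{c (Δ+1)} + c` points exists.
[cite: MediniShpilka2021, Cor 36 (CCC p.19:13; = arXiv ‹Cor 1.21› p0008.txt:L32-33)] -/
def MS2021_cor_36 : Prop :=
  ∃ c : ℕ, ∀ (K : Type) [Field K] (n Δ : ℕ), 4 ^ Δ ≤ n → (Infinite K ∨ n ^ 2 ≤ Nat.card K) →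
    ∃ H : Finset (Fin n → K), H.card ≤ n ^ (c * (Δ + 1)) + c ∧
      IsInterpolatingSetFor (↑H) (affOrbit n (anf K Δ))

end ReadOnceDensity

end Literature.Computability.AlgebraicComplexity

end
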